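import Literature.NumberTheory.Sieve.FGKMT2018SingularSeriesLowerBound
import Literature.NumberTheory.Sieve.Maynard2016DenseClustersTestFunction
import HarnessLib

/-!
# Maynard 2016, Lemma 8.2 — the arithmetic form for the pinned sieve data `y_r`

Source: J. Maynard, *Dense clusters of primes in subsets*, Compositio Math. 152 (2016) =
arXiv:1405.2593 [Maynard2016DenseClusters], Lemma 8.2 p. 15 (proof pp. 15–16, display (8.8)).

With `y_r = (WB)^k/φ(WB)^k · 𝔖_{WB}(𝓛) · F(log r₁/log R, …, log r_k/log R)` (`FGKMT2018.yVar`, the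
simplex indicator of `F` being irrelevant for Maynard's `F = F_k` of (7.4), which vanishes when
`∑ tᵢ ≥ 1`) and `Y_r` the same expression with `F₂` in place of `F`, Lemma 8.2 reads

* (i)  `r, s` with `s_i = r_i (i ≠ j)`, `s_j = A r_j`: `y_s = y_r + O(T_k Y_r log A/log R)`;
* (ii) `r, s` below a common `t` (`r_i, s_i ∣ t_i`; printed: `r = s` as integers, `t_i = [r_i, s_i]`,
  `A = ∏ t_i/∏ r_i = ∏ t_i/∏ s_i`): `y_s = y_r + O(T_k (Y_r + Y_s) log A/log R)`.

The analytic content — `|F(u + ε e_j) − F(u)| ≤ (30 + 30/U_k + T_k) ε F₂(u)` and its all-coordinates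
form — is `MaynardDense.abs_F_update_sub_le` / `abs_F_sub_F_le_of_le_of_le`
(`Maynard2016DenseClustersTestFunction` §§13–14); `30 + 30/U_k + T_k ≤ 3T_k` for `k ≥ 2^18`
(`MaynardDense.shift_const_le`). This file supplies the bookkeeping `u_i = log r_i/log R`:
`yVar_eq_mul_F` (the indicator drops), `abs_yVar_update_sub_le` (i), `abs_yVar_sub_yVar_le` (ii), with
the common prefactor `P = (WB)^k/φ(WB)^k 𝔖_{WB}(𝓛)` kept as `|P|` (it is positive for admissible
non-degenerate `𝓛`, `FGKMT2018.exp_neg_seven_mul_le_singSeriesExcl`; `yPref_pos`).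

## References
* J. Maynard, *Dense clusters of primes in subsets*, Compositio Math. 152 (2016), Lemma 8.2, (8.8)
  [Maynard2016DenseClusters].
-/

noncomputable section

open Finset Filter Real

namespace Literature.NumberTheory.Sieve.FGKMT2018

variable {k : ℕ}

/-- The point `u(r) = (log r₁/log R, …, log r_k/log R)` lies in the orthant when `rᵢ ≥ 1`, `R ≥ 1`.
[cite: Maynard2016DenseClusters, §7 p. 13 (the substitution `tᵢ = log rᵢ/log R`)] -/
theorem logVec_mem_orthant {R : ℝ} (hR : 1 ≤ R) (r : Fin k → ℕ) (hr : ∀ i, 1 ≤ r i) :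
    (fun i => Real.log (r i) / Real.log R) ∈ MaynardDense.orthant k := by
  refine MaynardDense.mem_orthant.2 fun i => ?_
  exact div_nonneg (Real.log_nonneg (by exact_mod_cast hr i)) (Real.log_nonneg hR)

/-- Maynard's `F = F_k` of (7.4) vanishes off the simplex inside the orthant (`ψ(∑ tᵢ) = 0` for
`∑ tᵢ ≥ 1`), so the simplex indicator in `y_r` is irrelevant for it.
[cite: Maynard2016DenseClusters, (7.4) p. 13 («F supported on ∑ tᵢ ≤ 1»)] -/
theorem indicator_simplex_F_eq {t : Fin k → ℝ} (ht : t ∈ MaynardDense.orthant k) :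
    (maynardSimplex k).indicator (MaynardDense.F k) t = MaynardDense.F k t := by
  by_cases hmem : t ∈ maynardSimplex k
  · exact Set.indicator_of_mem hmem _
  · rw [Set.indicator_of_notMem hmem]
    have ht0 : ∀ i, 0 ≤ t i := fun i => MaynardDense.mem_orthant.1 ht i
    have hsum : 1 ≤ ∑ i, t i := by
      by_contra h
      exact hmem ⟨ht0, (not_le.1 h).le⟩
    unfold MaynardDense.F
    rw [MaynardDense.psi_eq_zero hsum, zero_mul]

/-- `y_r = (WB)^k/φ(WB)^k · 𝔖_{WB}(𝓛) · F_k(u(r))` for `rᵢ ≥ 1`, `R ≥ 1` (no indicator).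
[cite: Maynard2016DenseClusters, §7 p. 14 (choice of `y_r`)] -/
theorem yVar_eq_mul_F (L : Fin k → ℤ × ℤ) (B : ℕ) {R : ℝ} (hR : 1 ≤ R) (r : Fin k → ℕ)
    (hr : ∀ i, 1 ≤ r i) :
    yVar L B R (MaynardDense.F k) r =
      ((wCut k B * B : ℕ) : ℝ) ^ k / (Nat.totient (wCut k B * B) : ℝ) ^ k *
        singSeriesExcl L (wCut k B * B) * MaynardDense.F k (fun i => Real.log (r i) / Real.log R) := by
  unfold yVar
  rw [indicator_simplex_F_eq (logVec_mem_orthant hR r hr)]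

/-- The prefactor `(WB)^k/φ(WB)^k · 𝔖_{WB}(𝓛)` of `y_r`, `Y_r` is positive for admissible
non-degenerate `𝓛` (`𝔖_{WB} ≥ e^{−7k}`, Lemma 8.1). [cite: Maynard2016DenseClusters, Lemma 8.1 (i), §7 p. 14] -/
theorem yPref_pos {L : Fin k → ℤ × ℤ} (hadm : FormsAdmissible L) (hnd : FormsNondegenerate L)
    (hk : 1 ≤ k) {B : ℕ} (hB : B ≠ 0) :
    0 < ((wCut k B * B : ℕ) : ℝ) ^ k / (Nat.totient (wCut k B * B) : ℝ) ^ k *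
      singSeriesExcl L (wCut k B * B) := by
  have hW : wCut k B ≠ 0 := by
    unfold wCut
    exact Finset.prod_ne_zero_iff.2 fun p hp => (Finset.mem_filter.1 hp).2.1.ne_zero
  have hWB : 0 < wCut k B * B := Nat.pos_of_ne_zero (mul_ne_zero hW hB)
  have hφ : 0 < ((Nat.totient (wCut k B * B) : ℕ) : ℝ) := by exact_mod_cast Nat.totient_pos.2 hWB
  have hS := exp_neg_seven_mul_le_singSeriesExcl hadm hnd hk (wCut k B * B)
  have hS0 : 0 < singSeriesExcl L (wCut k B * B) := (Real.exp_pos _).trans_le hS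
  have hWB' : (0 : ℝ) < ((wCut k B * B : ℕ) : ℝ) := by exact_mod_cast hWB
  positivity

/-- Coordinates of `u(s)` for `s = r` with `s_j = A r_j`: `u(s) = u(r) + (log A/log R) e_j`.
[cite: Maynard2016DenseClusters, Lemma 8.2 (i), proof p. 16] -/
theorem logVec_update (R : ℝ) (r : Fin k → ℕ) (hr : ∀ i, 1 ≤ r i) (j : Fin k) {A : ℕ}
    (hA : 1 ≤ A) :
    (fun i => Real.log ((Function.update r j (A * r j) i : ℕ) : ℝ) / Real.log R) =
      Function.update (fun i => Real.log (r i) / Real.log R) j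
        (Real.log (r j) / Real.log R + Real.log A / Real.log R) := by
  funext i
  by_cases hij : i = j
  · subst hij
    simp only [Function.update_self]
    have hr0 : (r i : ℝ) ≠ 0 := by exact_mod_cast Nat.one_le_iff_ne_zero.1 (hr i)
    have hA0 : (A : ℝ) ≠ 0 := by exact_mod_cast (Nat.one_le_iff_ne_zero.1 hA)
    push_cast
    rw [Real.log_mul hA0 hr0]
    ring
  · simp only [Function.update_of_ne hij]

/-- **[Maynard2016DenseClusters, Lemma 8.2 (i)]** for the pinned data: for `rᵢ ≥ 1`, `R > 1`,
`A ≥ 1` and `s = r` except `s_j = A r_j`,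
`|y_s − y_r| ≤ (30 + 30/U_k + T_k) (log A/log R) · |P| F₂(u(r))` with
`P = (WB)^k/φ(WB)^k 𝔖_{WB}(𝓛)` (so `|P| F₂(u(r)) = Y_r`), i.e. `y_s = y_r + O(T_k Y_r log A/log R)`.
[cite: Maynard2016DenseClusters, Lemma 8.2 (i) p. 15, (8.8)] -/
theorem abs_yVar_update_sub_le (hk : 2 ≤ k) (L : Fin k → ℤ × ℤ) (B : ℕ) {R : ℝ} (hR : 1 < R)
    (r : Fin k → ℕ) (hr : ∀ i, 1 ≤ r i) (j : Fin k) {A : ℕ} (hA : 1 ≤ A) :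
    |yVar L B R (MaynardDense.F k) (Function.update r j (A * r j)) -
        yVar L B R (MaynardDense.F k) r| ≤
      (30 + 30 / MaynardDense.U k + MaynardDense.T k) * (Real.log A / Real.log R) *
        (|((wCut k B * B : ℕ) : ℝ) ^ k / (Nat.totient (wCut k B * B) : ℝ) ^ k *
            singSeriesExcl L (wCut k B * B)| *
          MaynardDense.F₂ k (fun i => Real.log (r i) / Real.log R)) := by
  set P := ((wCut k B * B : ℕ) : ℝ) ^ k / (Nat.totient (wCut k B * B) : ℝ) ^ k *
    singSeriesExcl L (wCut k B * B) with hP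
  set u : Fin k → ℝ := fun i => Real.log (r i) / Real.log R with hu
  have hs : ∀ i, 1 ≤ Function.update r j (A * r j) i := by
    intro i
    by_cases hij : i = j
    · subst hij; simp only [Function.update_self]; exact one_le_mul hA (hr i)  -- 1 ≤ A * r i
    · simp only [Function.update_of_ne hij]; exact hr i
  have hε : 0 ≤ Real.log A / Real.log R :=
    div_nonneg (Real.log_nonneg (by exact_mod_cast hA)) (Real.log_nonneg hR.le)
  have huo : u ∈ MaynardDense.orthant k := logVec_mem_orthant hR.le r hr
  rw [yVar_eq_mul_F L B hR.le _ hs, yVar_eq_mul_F L B hR.le r hr, logVec_update R r hr j hA,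
    ← mul_sub, abs_mul]
  have key := MaynardDense.abs_F_update_sub_le hk huo j hε
  calc |P| * |MaynardDense.F k (Function.update u j (u j + Real.log A / Real.log R)) -
          MaynardDense.F k u|
      ≤ |P| * ((30 + 30 / MaynardDense.U k + MaynardDense.T k) * (Real.log A / Real.log R) *
          MaynardDense.F₂ k u) := mul_le_mul_of_nonneg_left key (abs_nonneg _)
    _ = _ := by ring

/-- **[Maynard2016DenseClusters, Lemma 8.2 (ii)]** for the pinned data: for `r, s, t` with
`rᵢ, sᵢ ≥ 1`, `rᵢ ≤ tᵢ`, `sᵢ ≤ tᵢ` (printed: `r = s` as integers, `tᵢ = [rᵢ, sᵢ]`) and `R > 1`,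
`|y_s − y_r| ≤ (30 + 30/U_k + T_k) · |P| · ((∑ᵢ log(tᵢ) − log(rᵢ))/log R · F₂(u(r))
  + (∑ᵢ log(tᵢ) − log(sᵢ))/log R · F₂(u(s)))`, i.e. `y_s = y_r + O(T_k (Y_r + Y_s) log A/log R)`
with `A = ∏ tᵢ/rᵢ` (resp. `∏ tᵢ/sᵢ`). [cite: Maynard2016DenseClusters, Lemma 8.2 (ii) p. 15, proof p. 16] -/
theorem abs_yVar_sub_yVar_le (hk : 2 ≤ k) (L : Fin k → ℤ × ℤ) (B : ℕ) {R : ℝ} (hR : 1 < R)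
    (r s t : Fin k → ℕ) (hr : ∀ i, 1 ≤ r i) (hs : ∀ i, 1 ≤ s i) (hrt : ∀ i, r i ≤ t i)
    (hst : ∀ i, s i ≤ t i) :
    |yVar L B R (MaynardDense.F k) s - yVar L B R (MaynardDense.F k) r| ≤
      (30 + 30 / MaynardDense.U k + MaynardDense.T k) *
        |((wCut k B * B : ℕ) : ℝ) ^ k / (Nat.totient (wCut k B * B) : ℝ) ^ k *
            singSeriesExcl L (wCut k B * B)| *
        ((∑ i, (Real.log (t i) - Real.log (r i))) / Real.log R *
            MaynardDense.F₂ k (fun i => Real.log (r i) / Real.log R) +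
          (∑ i, (Real.log (t i) - Real.log (s i))) / Real.log R *
            MaynardDense.F₂ k (fun i => Real.log (s i) / Real.log R)) := by
  set P := ((wCut k B * B : ℕ) : ℝ) ^ k / (Nat.totient (wCut k B * B) : ℝ) ^ k *
    singSeriesExcl L (wCut k B * B) with hP
  set u : Fin k → ℝ := fun i => Real.log (r i) / Real.log R with hu
  set v : Fin k → ℝ := fun i => Real.log (s i) / Real.log R with hv
  set w : Fin k → ℝ := fun i => Real.log (t i) / Real.log R with hw
  have hlogR : 0 ≤ Real.log R := Real.log_nonneg hR.le
  have huo : u ∈ MaynardDense.orthant k := logVec_mem_orthant hR.le r hr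
  have hvo : v ∈ MaynardDense.orthant k := logVec_mem_orthant hR.le s hs
  have mono : ∀ {a b : ℕ}, 1 ≤ a → a ≤ b → Real.log a / Real.log R ≤ Real.log b / Real.log R :=
    fun ha hab => div_le_div_of_nonneg_right
      (Real.log_le_log (by exact_mod_cast ha) (by exact_mod_cast hab)) hlogR
  have huw : ∀ i, u i ≤ w i := fun i => mono (hr i) (hrt i)
  have hvw : ∀ i, v i ≤ w i := fun i => mono (hs i) (hst i)
  rw [yVar_eq_mul_F L B hR.le s hs, yVar_eq_mul_F L B hR.le r hr, ← mul_sub, abs_mul]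
  have key := MaynardDense.abs_F_sub_F_le_of_le_of_le hk huo hvo huw hvw
  have e1 : (∑ i, (w i - u i)) = (∑ i, (Real.log (t i) - Real.log (r i))) / Real.log R := by
    rw [Finset.sum_div]
    exact Finset.sum_congr rfl fun i _ => by rw [hw, hu, sub_div]
  have e2 : (∑ i, (w i - v i)) = (∑ i, (Real.log (t i) - Real.log (s i))) / Real.log R := by
    rw [Finset.sum_div]
    exact Finset.sum_congr rfl fun i _ => by rw [hw, hv, sub_div]
  rw [e1, e2] at key
  calc |P| * |MaynardDense.F k v - MaynardDense.F k u|
      ≤ |P| * ((30 + 30 / MaynardDense.U k + MaynardDense.T k) *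
          ((∑ i, (Real.log (t i) - Real.log (r i))) / Real.log R * MaynardDense.F₂ k u +
            (∑ i, (Real.log (t i) - Real.log (s i))) / Real.log R * MaynardDense.F₂ k v)) :=
        mul_le_mul_of_nonneg_left key (abs_nonneg _)
    _ = _ := by ring

end Literature.NumberTheory.Sieve.FGKMT2018
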